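import Summits.RiemannHypothesis.RiemannHypothesis.Theorems.JensenPolynomialsFarGumbelValue
import Summits.RiemannHypothesis.RiemannHypothesis.Theorems.JensenPolynomialsFarGumbelSaddle

/-!
# Route `JensenPolynomials`, FAR crux `XiWindowZeroFreeRelFar` (B1-rel far) — S3 WANTED item (L5) `wanted_value`, closed
(RH-FREE; cell rh-jensen, HUMAN RULING D-0040)

Item `stmt-RiemannHypothesis-19465`, stub S3 `stub_laplaceFar`, WANTED list v3 (HOME `eng-4/S3/S3-WANTED.lean`, sha16
`d6f8107cd04d985a`), item (L5) `wanted_value` (name + signature verbatim) = eng-2 g3's reduction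
`wanted_value_of_saddle_curvature` (p458119: (L1) ∧ (L2) ⇒ (L5) by two mean-value steps on the disc and the one-point identity
`farPsi_center_eq` at `u₀`) applied to the landed (L1) `wanted_saddle` (eng-4 g3) and (L2) `wanted_curvature` (eng-4 g3, p456150).
WHAT THIS IS NOT: a one-line composition; nothing here bears on the zeros of `ζ` or the truth of RH.
-/

noncomputable section
-- D-0017: `Summit.RiemannHypothesis.RiemannHypothesis.…` duplicates the namespace BY DESIGN (single-problem summit).
set_option linter.dupNamespace false

namespace Summit.RiemannHypothesis.RiemannHypothesis.Theorems.JensenPolynomials.FarGumbel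

open Complex Metric
open scoped Real

/-- **(L5) of the S3 WANTED list v3: the value on the saddle disc vs `farMain`.** For the far mode `υ`, `‖a‖ ≤ (9/25)υ²`
and every `u` with `‖u − (υ + ξ₀/4)‖ ≤ 1/(10υ²)`:
`|Re Ψ(u) + ½(log π − log‖Ψ″(u)/2‖) − farMain M υ (a/υ²)| ≤ Λ/υ³ + 5`. -/
theorem wanted_value (M : ℕ) (hM : 2 * 10 ^ 18 ≤ M) (υ : ℝ)
    (hυ : (189 / 20 : ℝ) ≤ υ ∧ 4 * Real.pi * Real.exp (4 * υ) * υ = 2 * (M : ℝ) + 9 * υ)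
    (a : ℂ) (ha : ‖a‖ ≤ (9 / 25 : ℝ) * υ ^ 2) (u : ℂ)
    (hu : ‖u - ((υ : ℂ) + farXi0 (farW (a / (υ : ℂ) ^ 2)) (1 / υ) / 4)‖ ≤ 1 / (10 * υ ^ 2)) :
    |(farPsi M a u).re + 1 / 2 * (Real.log π - Real.log ‖farPsi2 M a u / 2‖) - farMain M υ (a / (υ : ℂ) ^ 2)| ≤
      farLam υ / υ ^ 3 + 5 :=
  wanted_value_of_saddle_curvature M υ hυ a ha (wanted_saddle M hM υ hυ a ha)
    (fun v hv => wanted_curvature M hM υ hυ a ha v hv) u hu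

end Summit.RiemannHypothesis.RiemannHypothesis.Theorems.JensenPolynomials.FarGumbel

end
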